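import Mathlib
import HarnessLib
import Summits.QuantumAdvantage.QuantumAdvantage.Theorems.LengthDialF
import Summits.QuantumAdvantage.QuantumAdvantage.Theorems.AbsorptionDialA

/-!
# SyndeticDial, part A/2 (§1 the WINDOW LAW in value form, §2 the EXTENSION LAW) — support for item stmt-QuantumAdvantage-28401

Cell decomp-qadv, seat lens-5 («finite range + asymptotic regime + bridge»), generation 27 — land port of the node
«SyndeticDial» (published under the cell's HOME/decomp-qadv-lens-5/g27/SyndeticDial.lean, record NODE-g27.md; RESIDUAL MODE
on AbsorptionDial:28401 `MassHiQuasi`).  The node file with ONLY the namespace renamed `Theses.SyndeticDial → Theorems.SyndeticDial`,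
split into parts A (laws, Prop-definition `PerfectAt` only) and B (the gap dial, pieces and `closes` BY NAME; imports the route
file via `Theorems.LengthDialG`).  Tree facts reused by name, not restated: `AbsorptionDial.ringWinU_glue3_eq_windowAbsorb`,
`AbsorptionDial.hasDegF_windowAbsorb`, `AbsorptionDial.glue3_prefix/suffix`, `chargeRecursion`, `LengthDial.winCount_cons`,
`LengthDial.hasDegF_tail/mono/falseFn`, `RigidityLaws.ringWinU_congr_mod`, `Smolensky.bitFn_mem_lowDeg/mul_mem_lowDeg_add/lowDeg_mono`.
No `sorry`, no new axioms, no instances, no notation.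

NODE SYNOPSIS (both parts): see part B's docstring and the node's module docstring (HOME copy).
-/

set_option autoImplicit false
set_option linter.dupNamespace false

namespace Summit.QuantumAdvantage.QuantumAdvantage.Theorems.SyndeticDial
open Finset
open Summit.QuantumAdvantage.AdviceFreeQNC0
open Literature.Computability.MetaComplexity Literature.Computability.MetaComplexity.Smolensky
open Summit.QuantumAdvantage.QuantumAdvantage.Theorems.LengthDial
open Summit.QuantumAdvantage.QuantumAdvantage.Theorems.AbsorptionDial

/-! ## §1 THE WINDOW LAW IN VALUE FORM (hardness moves UP in length at LINEAR degree cost) -/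

section Window

variable {k ℓ q : ℕ}

/-- the window coordinates of `a ++ w ++ b` read `w`. -/
theorem glue3_window (a : Fin k → Bool) (w : Fin ℓ → Bool) (b : Fin q → Bool) (j : Fin ℓ) :
    glue3 a w b (Fin.castAdd q (Fin.natAdd k j)) = w j := by
  unfold glue3; rw [Fin.append_left, Fin.append_right]

/-- the glue map `(a, b, w) ↦ a ++ w ++ b` is a bijection onto the inputs of length `k + ℓ + q`. -/
theorem glue3_bijective :
    Function.Bijective fun t : (Fin k → Bool) × (Fin q → Bool) × (Fin ℓ → Bool) => glue3 t.1 t.2.2 t.2.1 := by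
  rw [Fintype.bijective_iff_injective_and_card]
  refine ⟨?_, ?_⟩
  · rintro ⟨a, b, w⟩ ⟨a', b', w'⟩ h
    have h' : glue3 a w b = glue3 a' w' b' := h
    have ha : a = a' := funext fun i => by
      have := congrFun h' (Fin.castAdd q (Fin.castAdd ℓ i)); rwa [glue3_prefix, glue3_prefix] at this
    have hb : b = b' := funext fun j => by
      have := congrFun h' (Fin.natAdd (k + ℓ) j); rwa [glue3_suffix, glue3_suffix] at this
    have hw : w = w' := funext fun j => by
      have := congrFun h' (Fin.castAdd q (Fin.natAdd k j)); rwa [glue3_window, glue3_window] at this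
    rw [ha, hb, hw]
  · simp only [Fintype.card_prod, Fintype.card_fun, Fintype.card_bool, Fintype.card_fin]
    rw [pow_add, pow_add]; ring

variable (c : ℕ) (y : Fin (k + ℓ + q + 1) → (Fin (k + ℓ + q) → Bool) → Bool)

/-- **FIBRE PARTITION OF THE WIN COUNT** (`ℓ ≥ 1`): the wins of `y` at charge `c` are the wins, summed over the
`2^k · 2^q` window fibres `a ++ · ++ b`, of the ABSORBED WINDOW STRATEGIES `windowAbsorb c y a b` (plain walk game on
`ℓ` bits, charge `inCharge c a b`) — the tree's window-absorption identity `ringWinU_glue3_eq_windowAbsorb`, counted. -/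
theorem winCount_window (hℓ : 1 ≤ ℓ) :
    winCount (k + ℓ + q) c y
      = ∑ a : Fin k → Bool, ∑ b : Fin q → Bool, winCount ℓ (inCharge c a b) (windowAbsorb c y a b) := by
  classical
  have h1 : winCount (k + ℓ + q) c y = (univ.filter fun t : (Fin k → Bool) × (Fin q → Bool) × (Fin ℓ → Bool) =>
      ringWinU c y (glue3 t.1 t.2.2 t.2.1) = true).card := by
    unfold winCount
    rw [← Finset.map_univ_equiv (Equiv.ofBijective _ (glue3_bijective (k := k) (ℓ := ℓ) (q := q))),
      Finset.filter_map, Finset.card_map]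
    rfl
  rw [h1, Finset.card_filter, Fintype.sum_prod_type]
  refine Finset.sum_congr rfl fun a _ => ?_
  rw [Fintype.sum_prod_type]
  refine Finset.sum_congr rfl fun b _ => ?_
  unfold winCount
  rw [Finset.card_filter]
  refine Finset.sum_congr rfl fun w _ => ?_
  rw [ringWinU_glue3_eq_windowAbsorb c y hℓ a b w]

variable {p : ℕ} [Fact p.Prime]

/-- **THE WINDOW LAW, VALUE FORM.**  Hardness `θ` of the plain walk game at length `ℓ ≥ 1` (all charges) against cut
degree `D` forces hardness `θ` at EVERY longer length `k + ℓ + q` against cut degree `d` as soon as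
`d + 2(k+q)d + 1 ≤ D`: each fibre's absorbed window strategy has degree `≤ d + 2(k+q)d + 1` (`hasDegF_windowAbsorb`)
and wins at most `θ·2^ℓ` of its fibre.  (Supersedes g26 `LengthDial.reach`, whose cost was `5^s` for `s` extra bits.) -/
theorem hardR_of_window {d D : ℕ} {θ : ℝ} (hℓ : 1 ≤ ℓ) (h : HardR p ℓ D θ)
    (hD : d + (2 * ((k + q) * d) + 1) ≤ D) : HardR p (k + ℓ + q) d θ := by
  intro c y hy
  rw [winCount_window c y hℓ]
  push_cast
  have hterm : ∀ (a : Fin k → Bool) (b : Fin q → Bool),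
      (winCount ℓ (inCharge c a b) (windowAbsorb c y a b) : ℝ) ≤ θ * 2 ^ ℓ := fun a b =>
    h _ _ fun g => hasDegF_mono (hasDegF_windowAbsorb c y hy a b g) hD
  calc ∑ a : Fin k → Bool, ∑ b : Fin q → Bool, (winCount ℓ (inCharge c a b) (windowAbsorb c y a b) : ℝ)
      ≤ ∑ a : Fin k → Bool, ∑ b : Fin q → Bool, θ * 2 ^ ℓ :=
        Finset.sum_le_sum fun a _ => Finset.sum_le_sum fun b _ => hterm a b
    _ = θ * 2 ^ (k + ℓ + q) := by
        rw [Finset.sum_const, Finset.sum_const, Finset.card_univ, Finset.card_univ, Fintype.card_fun,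
          Fintype.card_fun, Fintype.card_bool, Fintype.card_fin, Fintype.card_fin]
        simp only [nsmul_eq_mul]
        push_cast
        ring

/-- the prefix form (`q = 0`): hardness at length `ℓ ≥ 1` against degree `D ≥ d + 2kd + 1` gives hardness at
length `k + ℓ` against degree `d`, same value bound. -/
theorem hardR_of_prefix {d D : ℕ} {θ : ℝ} (hℓ : 1 ≤ ℓ) (h : HardR p ℓ D θ)
    (hD : d + (2 * (k * d) + 1) ≤ D) : HardR p (k + ℓ) d θ := by
  have hw := hardR_of_window (k := k) (q := 0) hℓ h (by simpa using hD)
  simpa using hw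

end Window

/-! ## §2 THE EXTENSION LAW (easiness moves UP in length at degree cost ONE per bit: charge multiplexing) -/

section Mux

variable {k : ℕ}

/-- **the charge multiplexer**: at length `k + 1`, cut `0` is silent and cut `h + 1` plays `y₁ h` on the tail when
bit `0` is set, `y₀ h` otherwise. -/
def mux (y₀ y₁ : Fin (k + 1) → (Fin k → Bool) → Bool) : Fin (k + 2) → (Fin (k + 1) → Bool) → Bool :=
  Fin.cons (fun _ => false) (fun h u => bif u 0 then y₁ h (Fin.tail u) else y₀ h (Fin.tail u))

/-- on the face `b` the multiplexer plays `y_b` at charge `c + 1 + 2b` (the tree's charge recursion). -/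
theorem ringWinU_mux (c : ℕ) (y₀ y₁ : Fin (k + 1) → (Fin k → Bool) → Bool) (b : Bool) (u' : Fin k → Bool) :
    ringWinU c (mux y₀ y₁) (Fin.cons b u') = ringWinU (c + 1 + 2 * b.toNat) (bif b then y₁ else y₀) u' := by
  rw [chargeRecursion k c (mux y₀ y₁) b u']
  have h0 : mux y₀ y₁ 0 (Fin.cons b u') = false := by
    unfold mux; rw [Fin.cons_zero]
  have h1 : (fun (h : Fin (k + 1)) (v : Fin k → Bool) => mux y₀ y₁ h.succ (Fin.cons b v)) = bif b then y₁ else y₀ := by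
    funext h v
    unfold mux
    rw [Fin.cons_succ, Fin.cons_zero, Fin.tail_cons]
    cases b <;> rfl
  rw [h0, h1, Bool.false_and, Bool.false_xor]

/-- **THE EXTENSION IDENTITY**: `#win_{k+1}(c, mux y₀ y₁) = #win_k(c+1, y₀) + #win_k(c, y₁)`. -/
theorem winCount_mux (c : ℕ) (y₀ y₁ : Fin (k + 1) → (Fin k → Bool) → Bool) :
    winCount (k + 1) c (mux y₀ y₁) = winCount k (c + 1) y₀ + winCount k c y₁ := by
  rw [winCount_cons, Fintype.sum_bool]
  have ht : (univ.filter fun u' : Fin k → Bool => ringWinU c (mux y₀ y₁) (Fin.cons true u') = true).card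
      = winCount k c y₁ := by
    unfold winCount
    have e : ∀ u', ringWinU c (mux y₀ y₁) (Fin.cons true u') = ringWinU c y₁ u' := fun u' => by
      rw [ringWinU_mux, RigidityLaws.ringWinU_congr_mod _ c (by simp only [Bool.toNat_true]; omega)]
      rfl
    simp_rw [e]
  have hf : (univ.filter fun u' : Fin k → Bool => ringWinU c (mux y₀ y₁) (Fin.cons false u') = true).card
      = winCount k (c + 1) y₀ := by
    unfold winCount
    have e : ∀ u', ringWinU c (mux y₀ y₁) (Fin.cons false u') = ringWinU (c + 1) y₀ u' := fun u' => by
      rw [ringWinU_mux]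
      rfl
    simp_rw [e]
  rw [ht, hf, Nat.add_comm]

variable {p : ℕ} [Fact p.Prime]

/-- **degree of the multiplexer**: `≤ D + 1` (`[mux] = u₀·[y₁ ∘ tail] + (1 − u₀)·[y₀ ∘ tail]` over `𝔽_p`). -/
theorem hasDegF_mux {D : ℕ} {y₀ y₁ : Fin (k + 1) → (Fin k → Bool) → Bool} (h₀ : ∀ g, HasDegF p (y₀ g) D)
    (h₁ : ∀ g, HasDegF p (y₁ g) D) (g : Fin (k + 2)) : HasDegF p (mux y₀ y₁ g) (D + 1) := by
  refine Fin.cases ?_ (fun h => ?_) g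
  · unfold mux
    rw [Fin.cons_zero]
    exact hasDegF_falseFn (D + 1)
  · unfold mux
    rw [Fin.cons_succ]
    have hA : HasDegF p (fun u : Fin (k + 1) → Bool => y₁ h (Fin.tail u)) D := hasDegF_tail (h₁ h)
    have hB : HasDegF p (fun u : Fin (k + 1) → Bool => y₀ h (Fin.tail u)) D := hasDegF_tail (h₀ h)
    unfold HasDegF at hA hB ⊢
    have hbit : (fun u : Fin (k + 1) → Bool => if u 0 then (1 : ZMod p) else 0) ∈ lowDeg (ZMod p) (k + 1) 1 :=
      bitFn_mem_lowDeg 0 le_rfl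
    have key : (fun u : Fin (k + 1) → Bool =>
          if (bif u 0 then y₁ h (Fin.tail u) else y₀ h (Fin.tail u)) = true then (1 : ZMod p) else 0)
        = (fun u : Fin (k + 1) → Bool => if u 0 then (1 : ZMod p) else 0)
            * (fun u : Fin (k + 1) → Bool => if y₁ h (Fin.tail u) = true then (1 : ZMod p) else 0)
          + ((fun u : Fin (k + 1) → Bool => if y₀ h (Fin.tail u) = true then (1 : ZMod p) else 0)
            - (fun u : Fin (k + 1) → Bool => if u 0 then (1 : ZMod p) else 0)
              * (fun u : Fin (k + 1) → Bool => if y₀ h (Fin.tail u) = true then (1 : ZMod p) else 0)) := by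
      funext u
      simp only [Pi.add_apply, Pi.mul_apply, Pi.sub_apply]
      cases u 0 <;> cases y₁ h (Fin.tail u) <;> cases y₀ h (Fin.tail u) <;> simp
    rw [key, show D + 1 = 1 + D from Nat.add_comm _ _]
    exact Submodule.add_mem _ (mul_mem_lowDeg_add hbit hA)
      (Submodule.sub_mem _ (lowDeg_mono (by omega) hB) (mul_mem_lowDeg_add hbit hB))

/-- **PERFECT PLAY EXTENDS** (degree `+1` per bit): perfect strategies at length `k`, degree `D`, charges `c + 1`
and `c` give a perfect strategy at length `k + 1`, degree `D + 1`, charge `c`. -/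
theorem perfect_mux (c : ℕ) {y₀ y₁ : Fin (k + 1) → (Fin k → Bool) → Bool} (h₀ : ∀ u, ringWinU (c + 1) y₀ u = true)
    (h₁ : ∀ u, ringWinU c y₁ u = true) (u : Fin (k + 1) → Bool) : ringWinU c (mux y₀ y₁) u = true := by
  rw [← Fin.cons_self_tail u, ringWinU_mux]
  cases u 0
  · exact h₀ _
  · rw [RigidityLaws.ringWinU_congr_mod _ c (by simp only [Bool.toNat_true]; omega)]
    exact h₁ _

/-- **LOSSES ARE SUB-ADDITIVE UP THE DIAGONAL** (value form of the extension law): hardness `θ` at `(k+1, D+1)`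
forces, at `(k, D)`, that the best win counts of two CONSECUTIVE charges (two independent strategies) sum to at most
`2θ·2^k` — compare g26 `pairBound_of_hardR` (one strategy, same degree). -/
theorem pairBound_of_hardR_succ {D : ℕ} {θ : ℝ} (h : HardR p (k + 1) (D + 1) θ) (c : ℕ)
    (y₀ y₁ : Fin (k + 1) → (Fin k → Bool) → Bool) (h₀ : ∀ g, HasDegF p (y₀ g) D) (h₁ : ∀ g, HasDegF p (y₁ g) D) :
    (winCount k (c + 1) y₀ : ℝ) + winCount k c y₁ ≤ 2 * θ * 2 ^ k := by
  have h2 := h c (mux y₀ y₁) (hasDegF_mux h₀ h₁)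
  rw [winCount_mux, Nat.cast_add, pow_succ] at h2
  linarith

/-- perfect play at `(length m, degree D, charge c)`. -/
def PerfectAt (p : ℕ) [Fact p.Prime] (m D c : ℕ) : Prop :=
  ∃ y : Fin (m + 1) → (Fin m → Bool) → Bool, (∀ g, HasDegF p (y g) D) ∧ ∀ u, ringWinU c y u = true

/-- one diagonal step. -/
theorem perfectAt_succ {D c : ℕ} (h₀ : PerfectAt p k D (c + 1)) (h₁ : PerfectAt p k D c) :
    PerfectAt p (k + 1) (D + 1) c := by
  obtain ⟨y₀, hy₀, hw₀⟩ := h₀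
  obtain ⟨y₁, hy₁, hw₁⟩ := h₁
  exact ⟨mux y₀ y₁, hasDegF_mux hy₀ hy₁, perfect_mux c hw₀ hw₁⟩

/-- **ALL-CHARGE PERFECT PLAY PROPAGATES ALONG THE DIAGONAL**: perfect strategies at `(k, D)` for every charge
give perfect strategies at `(k + t, D + t)` for every charge and every `t` (INSTRUMENTABLE against the census's
least-perfect-degree tables: `d*(k + t) ≤ d*(k) + t`). -/
theorem allPerfect_add {D : ℕ} (h : ∀ c, PerfectAt p k D c) (t : ℕ) : ∀ c, PerfectAt p (k + t) (D + t) c := by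
  induction t with
  | zero => exact h
  | succ t ih => exact fun c => perfectAt_succ (ih (c + 1)) (ih c)

end Mux

end Summit.QuantumAdvantage.QuantumAdvantage.Theorems.SyndeticDial
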